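import Summits.QuantumFields.YangMills.Theorems.ColdStartUniversalityLatticeLangevinTimeAverageCLT
import Summits.QuantumFields.YangMills.Theorems.ColdStartUniversalityLatticeLangevinGreenKuboBilinear
import Mathlib.Probability.Distributions.Gaussian.Multivariate
import HarnessLib

/-!
# Route `ColdStartUniversality` (fixed-cut-off SZZ dynamics, sampler package): ★★★ THE MULTIVARIATE CENTRAL LIMIT THEOREM —
# `(T^(−1/2)∫₀ᵀ Ĝᵢ(U_r)dr)ᵢ ⇒ N(0, Σ)` with the GREEN–KUBO COVARIANCE MATRIX `Σᵢⱼ = ∫₀^∞ ⟨Ĝᵢ,κ_tĜⱼ⟩_μ + ⟨Ĝⱼ,κ_tĜᵢ⟩_μ dt`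

Helper file (seat `ym-line-csu-p1`, g35; `--supports stmt-QuantumFields-24809`).  Joint Gaussian fluctuations of finitely many observables (e.g.
several Wilson loops) of the cold-start SZZ sampler at fixed cut-off: for every coupling, every realising kernel family, EVERY strong solution from
EVERY deterministic start on ANY space, and continuous `|Gᵢ| ≤ 1`, `i ∈ ι` finite (★★★ `multivariate_timeAverage_clt`):
  (i) the Green–Kubo covariance matrix `Σ` is positive semidefinite (`v ⬝ Σv = σ²(ΣvᵢGᵢ) ≥ 0`, files 89/99a);
  (ii) along every `T_n → ∞`, the random vectors `(T_n^(−1/2) ∫_(0,T_n] (Gᵢ(U_r) − μ_(β')Gᵢ) dr)ᵢ ∈ ℝ^ι` converge IN DISTRIBUTION to the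
       multivariate Gaussian `N(0, Σ)` (Mathlib `multivariateGaussian 0 Σ` on `EuclideanSpace ℝ ι`, `TendstoInDistribution`).
Proof: Cramér–Wold — for `x ∈ ℝ^ι`, `⟪X_T, x⟫` is `c` times the statistic of the scalar observable `Σ(xᵢ/c)Gᵢ` (`c = Σ|xᵢ| + 1`), whose
CLT is file 94c; bilinearity (99a) identifies the limiting variance with `x ⬝ Σx`; Lévy's theorem in finite dimension
(`ProbabilityMeasure.tendsto_iff_tendsto_charFun`, `charFun_multivariateGaussian`); regular flow + pathwise uniqueness.  THEOREMS ONLY, no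
definition, no sorry; [folklore].  HONEST FRAMING: fixed cut-off; `Σ` depends on `L, β'`; `UniformColdStartMixing` (24809) is NOT restated; no crux,
rung or summit statement is proved; the Yang–Mills mass gap is NOT proved.
-/

set_option autoImplicit false

noncomputable section

namespace Summit.QuantumFields.YangMills.Theorems.ColdStartUniversality

open MeasureTheory ProbabilityTheory Filter Topology Set Matrix
open scoped NNReal ENNReal BigOperators
open Literature Literature.Probability.Process Literature.MathematicalPhysics.QuantumFieldTheory
open Literature.MathematicalPhysics.QuantumLattice (fundamentalRep fundamentalLatticeRep continuous_fundamentalRep)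

variable {L : ℕ} [NeZero L]

/-- ★★★ **MULTIVARIATE CLT for time averages of the cold-start SZZ sampler with the Green–Kubo covariance matrix.**  See the module docstring.
[folklore] -/
theorem multivariate_timeAverage_clt (L : ℕ) [NeZero L] (β' : ℝ)
    (κ : ℝ≥0 → Kernel (GaugeConfig 3 L (Matrix.specialUnitaryGroup (Fin 2) ℂ))
      (GaugeConfig 3 L (Matrix.specialUnitaryGroup (Fin 2) ℂ))) [∀ t, IsMarkovKernel (κ t)]
    (hreal : ∀ (t : ℝ≥0) (x : GaugeConfig 3 L (Matrix.specialUnitaryGroup (Fin 2) ℂ))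
        (Ω : Type) [MeasurableSpace Ω] (P : Measure Ω) [IsProbabilityMeasure P]
        (W : ℝ≥0 → Ω → (Edge 3 L × NoiseIdx 2 → ℝ)) (hW : IsFlatBrownian W P)
        (U : ℝ≥0 → Ω → GaugeConfig 3 L (Matrix.specialUnitaryGroup (Fin 2) ℂ)),
        (∀ ω, U 0 ω = x) →
        (latticeLangevinDynamics (fundamentalLatticeRep 2) β').IsSolution (fundamentalRep (Fin 2))
          hW.natFiltration P W U →
        κ t x = P.map (U t))
    (x₀ : GaugeConfig 3 L (Matrix.specialUnitaryGroup (Fin 2) ℂ))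
    {Ω : Type} [MeasurableSpace Ω] {P : Measure Ω} [IsProbabilityMeasure P]
    {W : ℝ≥0 → Ω → (Edge 3 L × NoiseIdx 2 → ℝ)} (hW : IsFlatBrownian W P)
    {U : ℝ≥0 → Ω → GaugeConfig 3 L (Matrix.specialUnitaryGroup (Fin 2) ℂ)} (hU0 : ∀ ω, U 0 ω = x₀)
    (hU : (latticeLangevinDynamics (fundamentalLatticeRep 2) β').IsSolution (fundamentalRep (Fin 2)) hW.natFiltration P W U)
    {ι : Type} [Fintype ι] [DecidableEq ι]
    {G : ι → GaugeConfig 3 L (Matrix.specialUnitaryGroup (Fin 2) ℂ) → ℝ} (hGc : ∀ i, Continuous (G i)) (hG1 : ∀ i z, |G i z| ≤ 1)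
    {S : Matrix ι ι ℝ}
    (hS : S = fun i j => ∫ t in Ioi (0 : ℝ),
      (∫ y, ((G i y - ∫ z, G i z ∂(wilsonMeasure (d := 3) (L := L) (fundamentalRep (Fin 2)) β')) *
          (∫ z, (G j z - ∫ z', G j z' ∂(wilsonMeasure (d := 3) (L := L) (fundamentalRep (Fin 2)) β')) ∂(κ t.toNNReal y)) +
        (G j y - ∫ z, G j z ∂(wilsonMeasure (d := 3) (L := L) (fundamentalRep (Fin 2)) β')) *
          (∫ z, (G i z - ∫ z', G i z' ∂(wilsonMeasure (d := 3) (L := L) (fundamentalRep (Fin 2)) β')) ∂(κ t.toNNReal y)))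
        ∂(wilsonMeasure (d := 3) (L := L) (fundamentalRep (Fin 2)) β'))) :
    S.PosSemidef ∧
    ∀ (Ω' : Type) [MeasurableSpace Ω'] (P' : Measure Ω') [IsProbabilityMeasure P'] (Y : Ω' → EuclideanSpace ℝ ι),
      HasLaw Y (multivariateGaussian 0 S) P' → ∀ (Tn : ℕ → ℝ), Tendsto Tn atTop atTop →
      TendstoInDistribution (fun (n : ℕ) ω => (WithLp.toLp 2 fun i => (Real.sqrt (Tn n))⁻¹ * ∫ r in Ioc (0 : ℝ) (Tn n),
        (G i (U r.toNNReal ω) - ∫ z, G i z ∂(wilsonMeasure (d := 3) (L := L) (fundamentalRep (Fin 2)) β')) : EuclideanSpace ℝ ι))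
        atTop Y (fun _ => P) P' := by
  classical
  haveI := secondCountableTopology_su2
  haveI := borelSpace_config L
  set μ : Measure (GaugeConfig 3 L (Matrix.specialUnitaryGroup (Fin 2) ℂ)) :=
    wilsonMeasure (d := 3) (L := L) (fundamentalRep (Fin 2)) β' with hμ
  haveI : IsProbabilityMeasure μ :=
    isProbabilityMeasure_wilsonMeasure (d := 3) (L := L) (fundamentalRep (Fin 2)) (continuous_fundamentalRep (Fin 2)) β'
  set m : ι → ℝ := fun i => ∫ z, G i z ∂μ with hm
  set Gh : ι → GaugeConfig 3 L (Matrix.specialUnitaryGroup (Fin 2) ℂ) → ℝ := fun i z => G i z - m i with hGh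
  have hGhc : ∀ i, Continuous (Gh i) := fun i => (hGc i).sub continuous_const
  have hm1 : ∀ i, |m i| ≤ 1 := fun i => by
    have hh := norm_integral_le_of_norm_le_const (μ := μ) (f := G i) (C := 1)
      (Eventually.of_forall fun z => by simpa [Real.norm_eq_abs] using hG1 i z)
    simpa [Real.norm_eq_abs] using hh
  have hGhb : ∀ i z, |Gh i z| ≤ 2 := fun i z => (abs_sub _ _).trans (by linarith [hG1 i z, hm1 i])
  -- the cross-correlation integrals `C i j`
  set C : ι → ι → ℝ := fun i j => ∫ t in Ioi (0 : ℝ), (∫ y, Gh i y * (∫ z, Gh j z ∂(κ t.toNNReal y)) ∂μ) with hC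
  have hcross : ∀ i j, IntegrableOn (fun t : ℝ => ∫ y, Gh i y * (∫ z, Gh j z ∂(κ t.toNNReal y)) ∂μ) (Ioi (0 : ℝ)) := fun i j =>
    (integrableOn_crossCorrelation L β' κ hreal (hGhc i) (hGhb i) (hGc j) (hG1 j)).2
  have hκm : ∀ j (t : ℝ≥0), Measurable fun y => ∫ z, Gh j z ∂(κ t y) := fun j t =>
    ((hGhc j).measurable.stronglyMeasurable.integral_kernel (κ := κ t)).measurable
  have hκb : ∀ j (t : ℝ≥0) y, |∫ z, Gh j z ∂(κ t y)| ≤ 2 := fun j t y => by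
    have hh := norm_integral_le_of_norm_le_const (μ := κ t y) (f := Gh j) (C := 2)
      (Eventually.of_forall fun z => by simpa [Real.norm_eq_abs] using hGhb j z)
    simpa [Real.norm_eq_abs] using hh
  have hprodi : ∀ i j (t : ℝ≥0), Integrable (fun y => Gh i y * ∫ z, Gh j z ∂(κ t y)) μ := fun i j t =>
    (integrable_const (2 * 2 : ℝ)).mono' ((hGhc i).measurable.mul (hκm j t)).aestronglyMeasurable
      (Eventually.of_forall fun y => by
        rw [Real.norm_eq_abs, abs_mul]; exact mul_le_mul (hGhb i y) (hκb j t y) (abs_nonneg _) (by norm_num))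
  have hSij : ∀ i j, S i j = C i j + C j i := fun i j => by
    rw [hS]
    simp only [hC]
    rw [← integral_add (hcross i j) (hcross j i)]
    exact integral_congr_ae (ae_of_all _ fun t => (integral_add (hprodi i j _) (hprodi j i _)))
  /- ### 1. The quadratic form of `S` is twice the Green–Kubo form of `Σ vᵢGᵢ` -/
  have hquad : ∀ v : ι → ℝ, v ⬝ᵥ (S *ᵥ v) = 2 * ∑ i, ∑ j, v i * v j * C i j := by
    intro v
    simp only [dotProduct, mulVec, hSij]
    have h1 : ∑ i, v i * ∑ j, (C i j + C j i) * v j = (∑ i, ∑ j, v i * v j * C i j) + ∑ i, ∑ j, v i * v j * C j i := by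
      rw [← Finset.sum_add_distrib]
      refine Finset.sum_congr rfl fun i _ => ?_
      rw [Finset.mul_sum, ← Finset.sum_add_distrib]
      exact Finset.sum_congr rfl fun j _ => by ring
    have h2 : ∑ i, ∑ j, v i * v j * C j i = ∑ i, ∑ j, v i * v j * C i j := by
      rw [Finset.sum_comm]
      exact Finset.sum_congr rfl fun i _ => Finset.sum_congr rfl fun j _ => by ring
    rw [h1, h2]; ring
  -- normalised linear combinations
  have hcomb : ∀ v : ι → ℝ, ∃ c : ℝ, 0 < c ∧ (∀ z, |∑ i, (v i / c) * G i z| ≤ 1) ∧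
      ∑ i, ∑ j, (v i / c) * (v j / c) * C i j = (∑ i, ∑ j, v i * v j * C i j) / c ^ 2 := by
    intro v
    refine ⟨∑ i, |v i| + 1, by positivity, fun z => ?_, ?_⟩
    · have hc : 0 < ∑ i, |v i| + 1 := by positivity
      calc |∑ i, v i / (∑ i, |v i| + 1) * G i z| ≤ ∑ i, |v i / (∑ i, |v i| + 1) * G i z| := Finset.abs_sum_le_sum_abs _ _
        _ ≤ ∑ i, |v i| / (∑ i, |v i| + 1) := Finset.sum_le_sum fun i _ => by
            rw [abs_mul, abs_div, abs_of_pos hc]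
            calc |v i| / (∑ i, |v i| + 1) * |G i z| ≤ |v i| / (∑ i, |v i| + 1) * 1 :=
                  mul_le_mul_of_nonneg_left (hG1 i z) (by positivity)
              _ = |v i| / (∑ i, |v i| + 1) := mul_one _
        _ = (∑ i, |v i|) / (∑ i, |v i| + 1) := by rw [Finset.sum_div]
        _ ≤ 1 := by rw [div_le_one hc]; linarith
    · rw [Finset.sum_div]
      refine Finset.sum_congr rfl fun i _ => ?_
      rw [Finset.sum_div]
      exact Finset.sum_congr rfl fun j _ => by field_simp
  -- Green–Kubo of the combination `Σ aᵢGᵢ` in terms of `C`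
  have hGK : ∀ a : ι → ℝ, ∫ t in Ioi (0 : ℝ), (∫ y, ((∑ i, a i * G i y) - ∫ z, (∑ i, a i * G i z) ∂μ) *
      (∫ z, ((∑ i, a i * G i z) - ∫ z', (∑ i, a i * G i z') ∂μ) ∂(κ t.toNNReal y)) ∂μ) = ∑ i, ∑ j, a i * a j * C i j := by
    intro a
    have hcen : ∀ z, (∑ i, a i * G i z) - ∫ z', (∑ i, a i * G i z') ∂μ = ∑ i, a i * Gh i z := fun z => by
      rw [integral_sum_mul_eq L hGc hG1 a μ, ← Finset.sum_sub_distrib]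
      exact Finset.sum_congr rfl fun i _ => by simp only [hGh]; ring
    simp_rw [hcen]
    exact greenKubo_sum_eq L β' κ hreal hGc hG1 a
  /- ### 2. Positive semidefiniteness -/
  have hPSD : S.PosSemidef := by
    refine Matrix.PosSemidef.of_dotProduct_mulVec_nonneg ?_ fun v => ?_
    · ext i j
      rw [Matrix.conjTranspose_apply, star_trivial, hSij, hSij, add_comm]
    · rw [star_trivial, hquad]
      obtain ⟨c, hc, hb1, hsc⟩ := hcomb v
      have h0 := greenKubo_nonneg L β' κ hreal (G := fun z => ∑ i, (v i / c) * G i z)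
        (continuous_finsetSum _ fun i _ => continuous_const.mul (hGc i)) hb1
      rw [hGK (fun i => v i / c), hsc] at h0
      have : 0 ≤ ∑ i, ∑ j, v i * v j * C i j := by
        have h1 := mul_nonneg h0 (sq_nonneg c)
        rwa [div_mul_cancel₀ _ (by positivity : c ^ 2 ≠ 0)] at h1
      linarith
  refine ⟨hPSD, fun Ω' _ P' _ Y hY Tn hTn => ?_⟩
  /- ### 3. Regular flow and the statistics -/
  obtain ⟨V, -, hV, hVprog, -, -, -⟩ := exists_regularFlow L β' hW
  have hprog : ∀ i : ℝ≥0, Measurable[@Prod.instMeasurableSpace (Set.Iic i) Ω inferInstance (hW.natFiltration i)]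
      (fun q : Set.Iic i × Ω => V x₀ q.1 q.2) := fun i =>
    (hVprog i).comp (measurable_fst.prodMk (measurable_const.prodMk measurable_snd))
  have hae : ∀ᵐ ω ∂P, ∀ t, U t ω = V x₀ t ω := latticeLangevin_pathwise_unique hW β' x₀ hU0 (hV x₀).1 hU (hV x₀).2
  have hpathm : Measurable fun q : Ω × ℝ => V x₀ q.2.toNNReal q.1 :=
    measurable_uncurry_of_prog (Z := V x₀) (fun n : ℕ => hW.natFiltration n) (fun n => hW.natFiltration.le n) (fun n => hprog n)
  set I : ι → ℝ → Ω → ℝ := fun i T ω => ∫ r in Ioc (0 : ℝ) T, Gh i (V x₀ r.toNNReal ω) with hI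
  have hIm : ∀ i T, Measurable (I i T) := fun i T => by
    have h1 : Measurable (Function.uncurry fun (ω : Ω) (r : ℝ) => Gh i (V x₀ r.toNNReal ω)) := (hGhc i).measurable.comp hpathm
    exact (h1.stronglyMeasurable.integral_prod_right' (ν := volume.restrict (Ioc (0 : ℝ) T))).measurable
  set XV : ℕ → Ω → EuclideanSpace ℝ ι := fun n ω => WithLp.toLp 2 fun i => (Real.sqrt (Tn n))⁻¹ * I i (Tn n) ω with hXV
  have hXVm : ∀ n, Measurable (XV n) := fun n =>
    (WithLp.measurable_toLp 2 _).comp (measurable_pi_lambda _ fun i => (hIm i _).const_mul _)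
  have hXU : ∀ n, (fun ω => (WithLp.toLp 2 fun i => (Real.sqrt (Tn n))⁻¹ * ∫ r in Ioc (0 : ℝ) (Tn n),
      (G i (U r.toNNReal ω) - ∫ z, G i z ∂μ) : EuclideanSpace ℝ ι)) =ᵐ[P] XV n := fun n => by
    filter_upwards [hae] with ω hω
    simp only [hXV, hI, hGh]
    congr 1
    funext i
    have : (fun r : ℝ => G i (U r.toNNReal ω) - m i) = fun r : ℝ => G i (V x₀ r.toNNReal ω) - m i := funext fun r => by rw [hω]
    rw [this]
  /- ### 4. Cramér–Wold: the characteristic function at `x` -/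
  have hchar : ∀ x : EuclideanSpace ℝ ι, Tendsto (fun n => ∫ ω, Complex.exp (((inner ℝ (XV n ω) x : ℝ) : ℂ) * Complex.I) ∂P) atTop
      (𝓝 (Complex.exp (-(((x.ofLp ⬝ᵥ (S *ᵥ x.ofLp)) / 2 : ℝ) : ℂ)))) := by
    intro x
    obtain ⟨c, hc, hb1, hsc⟩ := hcomb x.ofLp
    set a : ι → ℝ := fun i => x.ofLp i / c with ha
    set Ga : GaugeConfig 3 L (Matrix.specialUnitaryGroup (Fin 2) ℂ) → ℝ := fun z => ∑ i, a i * G i z with hGa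
    have hGac : Continuous Ga := continuous_finsetSum _ fun i _ => continuous_const.mul (hGc i)
    have hcen : ∀ z, Ga z - ∫ z', Ga z' ∂μ = ∑ i, a i * Gh i z := fun z => by
      simp only [hGa]
      rw [integral_sum_mul_eq L hGc hG1 a μ, ← Finset.sum_sub_distrib]
      exact Finset.sum_congr rfl fun i _ => by simp only [hGh]; ring
    -- the scalar CLT for `Ga` with `θ = c`
    have hclt := (timeAverage_clt L β' κ hreal x₀ hW (hV x₀).1 (hV x₀).2 hGac hb1 (σ2 := _) rfl).2.1 c
    have hcltn := hclt.comp hTn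
    -- identification of the exponent
    have hexp : c ^ 2 * (2 * ∫ t in Ioi (0 : ℝ), (∫ y, (Ga y - ∫ z, Ga z ∂μ) * (∫ z, (Ga z - ∫ z', Ga z' ∂μ) ∂(κ t.toNNReal y)) ∂μ)) / 2 =
        (x.ofLp ⬝ᵥ (S *ᵥ x.ofLp)) / 2 := by
      rw [hGK a, hsc, hquad]
      field_simp
    -- identification of the statistic: `⟪XV n ω, x⟫ = c · T^(−1/2) ∫ (Ga − μGa)(V_r) dr`
    have hstat : ∀ n ω, inner ℝ (XV n ω) x = c * ((Real.sqrt (Tn n))⁻¹ * ∫ r in Ioc (0 : ℝ) (Tn n), (Ga (V x₀ r.toNNReal ω) - ∫ z, Ga z ∂μ)) := by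
      intro n ω
      have hpath : ∀ i, IntegrableOn (fun r : ℝ => Gh i (V x₀ r.toNNReal ω)) (Ioc (0 : ℝ) (Tn n)) volume := fun i =>
        (integrableOn_const (C := (2 : ℝ)) (hs := measure_Ioc_lt_top.ne)).mono'
          (((hGhc i).measurable.comp (hpathm.comp (measurable_const.prodMk measurable_id))).aestronglyMeasurable)
          (Eventually.of_forall fun r => by rw [Real.norm_eq_abs]; exact hGhb i _)
      have hsum : ∫ r in Ioc (0 : ℝ) (Tn n), (Ga (V x₀ r.toNNReal ω) - ∫ z, Ga z ∂μ) = ∑ i, a i * I i (Tn n) ω := by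
        simp_rw [hcen]
        rw [integral_finsetSum _ fun i _ => (hpath i).const_mul _]
        exact Finset.sum_congr rfl fun i _ => integral_const_mul _ _
      rw [hsum]
      simp only [hXV, PiLp.inner_apply, RCLike.inner_apply, conj_trivial, ha]
      rw [Finset.mul_sum, Finset.mul_sum]
      refine Finset.sum_congr rfl fun i _ => ?_
      show x.ofLp i * ((Real.sqrt (Tn n))⁻¹ * I i (Tn n) ω) = c * ((Real.sqrt (Tn n))⁻¹ * (x.ofLp i / c * I i (Tn n) ω))
      field_simp
    simp_rw [hstat]
    rw [← hexp]
    exact hcltn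
  /- ### 5. Lévy in `ℝ^ι` and transfer to `U` -/
  have hV : TendstoInDistribution XV atTop Y (fun _ => P) P' := by
    refine ⟨fun n => (hXVm n).aemeasurable, hY.aemeasurable, ?_⟩
    refine ProbabilityMeasure.tendsto_iff_tendsto_charFun.2 fun x => ?_
    have hφ : Measurable fun v : EuclideanSpace ℝ ι => Complex.exp (((inner ℝ v x : ℝ) : ℂ) * Complex.I) :=
      ((Complex.measurable_ofReal.comp (continuous_id.inner continuous_const).measurable).mul_const _).cexp
    have hN : ∀ n, charFun (P.map (XV n)) x = ∫ ω, Complex.exp (((inner ℝ (XV n ω) x : ℝ) : ℂ) * Complex.I) ∂P := fun n => by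
      rw [charFun_apply, integral_map (hXVm n).aemeasurable hφ.aestronglyMeasurable]
    have hlim : charFun (P'.map Y) x = Complex.exp (-(((x.ofLp ⬝ᵥ (S *ᵥ x.ofLp)) / 2 : ℝ) : ℂ)) := by
      rw [hY.map_eq, charFun_multivariateGaussian hPSD]
      congr 1
      simp only [inner_zero_right, Complex.ofReal_zero, zero_mul, zero_sub]
      push_cast
      ring
    simp only [ProbabilityMeasure.coe_mk]
    rw [hlim]
    simp_rw [hN]
    exact hchar x
  exact hV.congr (fun n => (hXU n).symm) (ae_eq_refl _)

end Summit.QuantumFields.YangMills.Theorems.ColdStartUniversality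

end
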